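import Summits.MatrixMultiplication.MatrixMultiplication.Theorems.FarEdgeDescentWeightFamily
import HarnessLib

/-!
# `⟨2,2,2⟩^{⊠N} ⋭ 𝔖(q)^{⊠N}` for every `N ≥ 1`, every `q ∉ {0,1}`, every field

Route `FarEdgeDescent` (cell `decomp-mm`, lens 2 «structural dichotomy (special vs generic)»,
gen 32), Kernel VII; support for the aside `SubLogRate` (stmt-MatrixMultiplication-25371).

`FarEdgeDescentWeightFamily` isolated the coherent point `q = 1` of the Bläser–Christandl–Zuiddam
normal-form family `𝔖(q)` (all tensors with the support of `⟨2,2,2⟩`, up to the torus) at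
Kronecker level `N = 1`.  This file lifts the `x`-pencil commutant computation to all Kronecker
powers:

* `comm_fam_pow`: for `q ≠ 0, 1` every pair `(β, γ)` with `β · 𝔖(q)^{⊠N}(x) = 𝔖(q)^{⊠N}(x) · γ`
  for all `4^N` slices is a pair of EQUAL DIAGONAL matrices, constant on each of the `2^N`
  side-pattern blocks (`(β, γ) ∈ blockScalarsPow`, dimension `≤ 2^N`);
* `βpow_linearIndependent`, `hcommPow`: at `q = 1` the `4^N` operators `E_{s,t} ⊗ 1` commute;
* `matMul_pow_not_algDegeneratesTo_fam_pow`: hence, by BCS (15.19),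
  **`⟨2,2,2⟩^{⊠N} ⋭ 𝔖(q)^{⊠N}` for all `N ≥ 1` and all `q ∉ {0,1}`, over every field** —
  although `𝔖(q)^{⊠N}` has exactly the support of `⟨2^N,2^N,2^N⟩`.  At `q = -1` this is the
  edge `⟨2,2,2⟩^{⊠N} ⋭ (𝔖^♭)^{⊠N}` of `FarEdgeDescentSignTwist` (there: characteristic `≠ 2`, via
  the permutation model); the present argument is uniform in `q` and covers characteristic `2`
  (`|K| > 2`), where the sign classes collapse onto the coherent one and `𝔖(q)`, `q ∉ {0,1}`, are
  the generic same-support representatives.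

References: M. Bläser, M. Christandl, J. Zuiddam, arXiv:1705.09652, §2
[BlaserChristandlZuiddam2017]; P. Bürgisser, M. Clausen, M. A. Shokrollahi, *Algebraic
Complexity Theory* (1997), (15.19), §20.2 [BurgisserClausenShokrollahi1997].
-/

noncomputable section

open scoped BigOperators Matrix

set_option linter.dupNamespace false

namespace Summit.MatrixMultiplication.MatrixMultiplication.Theorems.FarEdgeDescentWeightFamilyPow

open Literature.Computability.AlgebraicComplexity
open Summit.MatrixMultiplication.MatrixMultiplication.Theorems.FarEdgeDescentCommutantObstruction
open Summit.MatrixMultiplication.MatrixMultiplication.Theorems.FarEdgeDescentTwistRigidity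
open Summit.MatrixMultiplication.MatrixMultiplication.Theorems.FarEdgeDescentSignTwist
open Summit.MatrixMultiplication.MatrixMultiplication.Theorems.FarEdgeDescentSignTwistDet
open Summit.MatrixMultiplication.MatrixMultiplication.Theorems.FarEdgeDescentSignTwistComm
open Summit.MatrixMultiplication.MatrixMultiplication.Theorems.FarEdgeDescentSignTwistCommPow
open Summit.MatrixMultiplication.MatrixMultiplication.Theorems.FarEdgeDescentWeightFamily

universe u

variable {K : Type u} [Field K] {N : ℕ}

/-! ## Leaves from side and row patterns -/

/-- `mkLeaf (side a) (row a) = a`. [folklore] -/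
@[simp] theorem mkLeaf_side_row (a : Leaf2) : mkLeaf (side a) (row a) = a := by
  rcases a with ⟨r, l⟩ | ⟨r, l⟩ <;> fin_cases l <;> rfl

/-- A leaf is determined by its side and row. [folklore] -/
theorem leaf_ext {a d : Leaf2} (hs : side a = side d) (hr : row a = row d) : a = d := by
  rw [← mkLeaf_side_row a, hs, hr, mkLeaf_side_row]

/-- The multi-leaf with side pattern `s` and row pattern `ρ`. [folklore] -/
def mk (s ρ : Fin N → Fin 2) : Fin N → Leaf2 := fun i => mkLeaf (s i) (ρ i)

/-- `side (mk s ρ i) = s i`. [folklore] -/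
@[simp] theorem side_mk (s ρ : Fin N → Fin 2) (i : Fin N) : side (mk s ρ i) = s i := by
  simp [mk]

/-- `row (mk s ρ i) = ρ i`. [folklore] -/
@[simp] theorem row_mk (s ρ : Fin N → Fin 2) (i : Fin N) : row (mk s ρ i) = ρ i := by
  simp [mk]

/-- Every multi-leaf is `mk side row`. [folklore] -/
theorem mk_side_row (a : Fin N → Leaf2) : mk (fun i => side (a i)) (fun i => row (a i)) = a :=
  funext fun i => by simp [mk]

/-- Diagonal weights are `1`. [folklore] -/
@[simp] theorem wS_diag (q : K) (σ r : Fin 2) : wS K q σ (r, r) = 1 := by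
  unfold wS famW; fin_cases r <;> simp

/-- Products of weights do not vanish (`q ≠ 0`). [folklore] -/
theorem prod_wS_ne_zero {q : K} (hq : q ≠ 0) (u : Fin N → Fin 2) (x : Fin N → Fin 2 × Fin 2) :
    ∏ i, wS K q (u i) (x i) ≠ 0 :=
  Finset.prod_ne_zero_iff.mpr fun i _ => wS_ne_zero K hq (u i) (x i)

/-! ## The two slice products of the Kronecker power -/

/-- `(M · 𝔖(q)^{⊠N}(x))(a,c) = [row c = x₂] · ∏ w_{side cᵢ}(xᵢ) · M(a, leaf(side c, x₁))`.
[folklore] -/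
theorem mul_slice_pow (q : K) (M : Matrix (Fin N → Leaf2) (Fin N → Leaf2) K)
    (x : Fin N → Fin 2 × Fin 2) (a c : Fin N → Leaf2) :
    (M * slice (kroneckerPow (fam K q) N) x) a c =
      if ∀ i, row (c i) = (x i).2 then
        (∏ i, wS K q (side (c i)) (x i)) * M a (fun i => mkLeaf (side (c i)) (x i).1) else 0 := by
  simp only [Matrix.mul_apply, slice_apply, kroneckerPow_apply]
  split_ifs with h
  · rw [Fintype.sum_eq_single (fun i => mkLeaf (side (c i)) (x i).1), mul_comm]
    · congr 1
      exact Finset.prod_congr rfl fun i _ => by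
        rw [fam_apply, side_mkLeaf, row_mkLeaf, if_pos ⟨rfl, Prod.ext rfl (h i).symm⟩]
    · intro d hd
      obtain ⟨i₁, hi₁⟩ := Function.ne_iff.mp hd
      rw [Finset.prod_eq_zero (Finset.mem_univ i₁), mul_zero]
      rw [fam_apply, if_neg]
      rintro ⟨hs, hx⟩
      exact hi₁ (by rw [← mkLeaf_side_row (d i₁), hs, hx])
  · obtain ⟨i₁, hi₁⟩ := not_forall.mp h
    refine Finset.sum_eq_zero fun d _ => ?_
    rw [Finset.prod_eq_zero (Finset.mem_univ i₁), mul_zero]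
    rw [fam_apply, if_neg]
    rintro ⟨-, hx⟩
    exact hi₁ (by rw [hx])

/-- `(𝔖(q)^{⊠N}(x) · M)(a,c) = [row a = x₁] · ∏ w_{side aᵢ}(xᵢ) · M(leaf(side a, x₂), c)`.
[folklore] -/
theorem slice_mul_pow (q : K) (M : Matrix (Fin N → Leaf2) (Fin N → Leaf2) K)
    (x : Fin N → Fin 2 × Fin 2) (a c : Fin N → Leaf2) :
    (slice (kroneckerPow (fam K q) N) x * M) a c =
      if ∀ i, row (a i) = (x i).1 then
        (∏ i, wS K q (side (a i)) (x i)) * M (fun i => mkLeaf (side (a i)) (x i).2) c else 0 := by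
  simp only [Matrix.mul_apply, slice_apply, kroneckerPow_apply]
  split_ifs with h
  · rw [Fintype.sum_eq_single (fun i => mkLeaf (side (a i)) (x i).2)]
    · congr 1
      exact Finset.prod_congr rfl fun i _ => by
        rw [fam_apply, side_mkLeaf, row_mkLeaf, if_pos ⟨rfl, Prod.ext (h i).symm rfl⟩]
    · intro e he
      obtain ⟨i₁, hi₁⟩ := Function.ne_iff.mp he
      rw [Finset.prod_eq_zero (Finset.mem_univ i₁), zero_mul]
      rw [fam_apply, if_neg]
      rintro ⟨hs, hx⟩
      exact hi₁ (by rw [← mkLeaf_side_row (e i₁), ← hs, hx])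
  · obtain ⟨i₁, hi₁⟩ := not_forall.mp h
    refine Finset.sum_eq_zero fun e _ => ?_
    rw [Finset.prod_eq_zero (Finset.mem_univ i₁), zero_mul]
    rw [fam_apply, if_neg]
    rintro ⟨-, hx⟩
    exact hi₁ (by rw [hx])

/-! ## The coherent point: `4^N` independent commuting operators -/

variable (K N)

/-- `βpow(s,t) = E_{st} ⊗ 1`: maps side pattern `t` to side pattern `s`, rows fixed. [folklore] -/
def βpow (p : (Fin N → Fin 2) × (Fin N → Fin 2)) : Matrix (Fin N → Leaf2) (Fin N → Leaf2) K :=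
  Matrix.of fun a d =>
    if (fun i => side (a i)) = p.1 ∧ (fun i => side (d i)) = p.2 ∧
        (fun i => row (a i)) = (fun i => row (d i)) then 1 else 0

/-- **The `4^N` operators commute with the slices of `𝔖(1)^{⊠N}`.**
[cite: BurgisserClausenShokrollahi1997, (15.19)] -/
theorem hcommPow (p : (Fin N → Fin 2) × (Fin N → Fin 2)) (x : Fin N → Fin 2 × Fin 2) :
    βpow K N p * slice (kroneckerPow (fam K 1) N) x =
      slice (kroneckerPow (fam K 1) N) x * βpow K N p := by
  ext a c
  rw [mul_slice_pow, slice_mul_pow]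
  simp only [wS_one, Finset.prod_const_one, one_mul, βpow, Matrix.of_apply, side_mkLeaf,
    row_mkLeaf, funext_iff]
  have hsymm : (∀ i, (x i).2 = row (c i)) ↔ (∀ i, row (c i) = (x i).2) :=
    ⟨fun h i => (h i).symm, fun h i => (h i).symm⟩
  simp only [hsymm]
  split_ifs <;> first | rfl | (exfalso; tauto)

/-- **The `4^N` operators are linearly independent.** [folklore] -/
theorem βpow_linearIndependent : LinearIndependent K (βpow K N) := by
  refine Fintype.linearIndependent_iff.mpr fun g hg p => ?_
  have key : (∑ p', g p' • βpow K N p') (mk p.1 (fun _ => 0)) (mk p.2 (fun _ => 0)) = g p := by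
    simp only [Matrix.sum_apply, Matrix.smul_apply, βpow, Matrix.of_apply, smul_eq_mul, mul_ite,
      mul_one, mul_zero, side_mk, row_mk, and_true]
    rw [Finset.sum_eq_single p]
    · simp
    · intro p' _ hp'
      rw [if_neg]
      exact fun h => hp' (Prod.ext h.1 h.2).symm
    · simp
  rw [hg] at key
  simpa using key.symm

/-! ## A generic point: the commutant of the power is block scalar -/

variable {K N}

/-- The weight of an elementary row move at coordinate `i₀`. [folklore] -/
theorem prod_wS_update {q : K} (u τ : Fin N → Fin 2) (i₀ : Fin N) (r r' : Fin 2) :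
    ∏ i, wS K q (u i) (Function.update τ i₀ r i, Function.update τ i₀ r' i) =
      wS K q (u i₀) (r, r') := by
  rw [← Finset.prod_erase_mul _ _ (Finset.mem_univ i₀), Function.update_self,
    Function.update_self, Finset.prod_eq_one, one_mul]
  intro i hi
  rw [Function.update_of_ne (Finset.ne_of_mem_erase hi),
    Function.update_of_ne (Finset.ne_of_mem_erase hi), wS_diag]


section Generic
variable {q : K} (hq0 : q ≠ 0) (hq1 : q ≠ 1)
  {β' γ' : Matrix (Fin N → Leaf2) (Fin N → Leaf2) K}
  (H : ∀ x, β' * slice (kroneckerPow (fam K q) N) x = slice (kroneckerPow (fam K q) N) x * γ')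
include H

/-- The entry equations of the commutation relation. [folklore] -/
theorem entryE (a c : Fin N → Leaf2) (x : Fin N → Fin 2 × Fin 2) :
    (if ∀ i, row (c i) = (x i).2 then
        (∏ i, wS K q (side (c i)) (x i)) * β' a (fun i => mkLeaf (side (c i)) (x i).1) else 0) =
      if ∀ i, row (a i) = (x i).1 then
        (∏ i, wS K q (side (a i)) (x i)) * γ' (fun i => mkLeaf (side (a i)) (x i).2) c else 0 := by
  have h := congr_fun (congr_fun (H x) a) c
  rwa [mul_slice_pow, slice_mul_pow] at h

include hq0

/-- `β'` vanishes off the row diagonal. [folklore] -/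
theorem Zβ {a d : Fin N → Leaf2} (h : ¬ ∀ i, row (a i) = row (d i)) : β' a d = 0 := by
  have e := entryE H a d (fun i => (row (d i), row (d i)))
  rw [if_pos (fun i => rfl), if_neg h] at e
  simp only [mkLeaf_side_row] at e
  exact (mul_eq_zero.mp e).resolve_left (prod_wS_ne_zero hq0 _ _)

/-- `γ'` vanishes off the row diagonal. [folklore] -/
theorem Zγ {d c : Fin N → Leaf2} (h : ¬ ∀ i, row (d i) = row (c i)) : γ' d c = 0 := by
  have e := entryE H d c (fun i => (row (d i), row (d i)))
  rw [if_pos (fun i => rfl), if_neg (fun h' => h fun i => (h' i).symm)] at e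
  simp only [mkLeaf_side_row] at e
  exact (mul_eq_zero.mp e.symm).resolve_left (prod_wS_ne_zero hq0 _ _)

omit hq0 in
/-- The relation between row-diagonal entries with side patterns `s, t`. [folklore] -/
theorem rel (s t ρ ρ' : Fin N → Fin 2) :
    (∏ i, wS K q (t i) (ρ i, ρ' i)) * β' (mk s ρ) (mk t ρ) =
      (∏ i, wS K q (s i) (ρ i, ρ' i)) * γ' (mk s ρ') (mk t ρ') := by
  have e := entryE H (mk s ρ) (mk t ρ') (fun i => (ρ i, ρ' i))
  rw [if_pos (fun i => row_mk _ _ i), if_pos (fun i => row_mk _ _ i)] at e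
  simp only [side_mk] at e
  exact e

/-- Same side pattern: `β'` and `γ'` are the constant `μ_s` on the block. [folklore] -/
theorem diag_eq (s ρ ρ' : Fin N → Fin 2) : β' (mk s ρ) (mk s ρ) = γ' (mk s ρ') (mk s ρ') :=
  mul_left_cancel₀ (prod_wS_ne_zero hq0 _ _) (rel H s s ρ ρ')

include hq1

omit hq0 in
/-- Different side patterns: the cross entries vanish (the four-term chain through `q`).
[folklore] -/
theorem cross_zero (s t : Fin N → Fin 2) {i₀ : Fin N} (hst : s i₀ ≠ t i₀) (τ : Fin N → Fin 2) :
    β' (mk s τ) (mk t τ) = 0 ∧ γ' (mk s τ) (mk t τ) = 0 := by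
  have R : ∀ r r' : Fin 2, wS K q (t i₀) (r, r') * β' (mk s (Function.update τ i₀ r))
      (mk t (Function.update τ i₀ r)) = wS K q (s i₀) (r, r') *
      γ' (mk s (Function.update τ i₀ r')) (mk t (Function.update τ i₀ r')) := by
    intro r r'
    have e := rel H s t (Function.update τ i₀ r) (Function.update τ i₀ r')
    rwa [prod_wS_update, prod_wS_update] at e
  have two : ∀ u : Fin 2, u = 0 ∨ u = 1 := by decide
  have hq1' : q - 1 ≠ 0 := sub_ne_zero.mpr hq1
  -- all four chain entries vanish
  have main : ∀ r : Fin 2, β' (mk s (Function.update τ i₀ r)) (mk t (Function.update τ i₀ r)) = 0 ∧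
      γ' (mk s (Function.update τ i₀ r)) (mk t (Function.update τ i₀ r)) = 0 := by
    have e00 := R 0 0
    have e01 := R 0 1
    have e11 := R 1 1
    have e10 := R 1 0
    rcases two (s i₀) with hs | hs <;> rcases two (t i₀) with ht | ht
    · exact absurd (hs.trans ht.symm) hst
    · simp only [hs, ht, wS, famW] at e00 e01 e11 e10
      norm_num at e00 e01 e11 e10
      have b1 : β' (mk s (Function.update τ i₀ 1)) (mk t (Function.update τ i₀ 1)) = 0 := by
        have : (q - 1) * β' (mk s (Function.update τ i₀ 1)) (mk t (Function.update τ i₀ 1)) =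
            0 := by
          linear_combination e10 - e00 + e01 - e11
        exact (mul_eq_zero.mp this).resolve_left hq1'
      have b0 : β' (mk s (Function.update τ i₀ 0)) (mk t (Function.update τ i₀ 0)) = 0 := by
        linear_combination e01 - e11 + b1
      intro r
      rcases two r with rfl | rfl
      · exact ⟨b0, by linear_combination b0 - e00⟩
      · exact ⟨b1, by linear_combination b1 - e11⟩
    · simp only [hs, ht, wS, famW] at e00 e01 e11 e10
      norm_num at e00 e01 e11 e10
      have g0 : γ' (mk s (Function.update τ i₀ 0)) (mk t (Function.update τ i₀ 0)) = 0 := by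
        have : (q - 1) * γ' (mk s (Function.update τ i₀ 0)) (mk t (Function.update τ i₀ 0)) =
            0 := by
          linear_combination e00 - e01 + e11 - e10
        exact (mul_eq_zero.mp this).resolve_left hq1'
      have b0 : β' (mk s (Function.update τ i₀ 0)) (mk t (Function.update τ i₀ 0)) = 0 := by
        linear_combination e00 + g0
      intro r
      rcases two r with rfl | rfl
      · exact ⟨b0, g0⟩
      · exact ⟨by linear_combination e11 - e01 + b0, by linear_combination -e01 + b0⟩
    · exact absurd (hs.trans ht.symm) hst
  have h := main (τ i₀)
  rwa [Function.update_eq_self] at h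

/-- **The commutant of `𝔖(q)^{⊠N}`, `q ∉ {0,1}`: equal diagonal block scalars.** [folklore] -/
theorem comm_fam_pow (a d : Fin N → Leaf2) :
    β' a d = (if a = d then β' (mk (fun i => side (a i)) fun _ => 0)
      (mk (fun i => side (a i)) fun _ => 0) else 0) ∧
    γ' a d = (if a = d then β' (mk (fun i => side (a i)) fun _ => 0)
      (mk (fun i => side (a i)) fun _ => 0) else 0) := by
  by_cases hr : ∀ i, row (a i) = row (d i)
  · by_cases hs : ∀ i, side (a i) = side (d i)
    · have had : a = d := funext fun i => leaf_ext (hs i) (hr i)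
      subst had
      rw [if_pos rfl]
      have h1 := diag_eq hq0 H (fun i => side (a i)) (fun i => row (a i)) (fun _ => 0)
      have h2 := diag_eq hq0 H (fun i => side (a i)) (fun _ => 0) (fun _ => 0)
      have h3 := diag_eq hq0 H (fun i => side (a i)) (fun _ => 0) (fun i => row (a i))
      rw [mk_side_row] at h1 h3
      exact ⟨h1.trans h2.symm, h3.symm⟩
    · obtain ⟨i₀, hi₀⟩ := not_forall.mp hs
      have had : a ≠ d := fun h => hi₀ (by rw [h])
      rw [if_neg had]
      have hc := cross_zero hq1 H (fun i => side (a i)) (fun i => side (d i)) hi₀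
        (fun i => row (a i))
      have ha : mk (fun i => side (a i)) (fun i => row (a i)) = a := mk_side_row a
      have hd : mk (fun i => side (d i)) (fun i => row (a i)) = d := by
        rw [show (fun i => row (a i)) = fun i => row (d i) from funext hr]; exact mk_side_row d
      rw [ha, hd] at hc
      exact hc
  · have had : a ≠ d := fun h => hr (fun i => by rw [h])
    rw [if_neg had]
    exact ⟨Zβ hq0 H hr, Zγ hq0 H hr⟩

end Generic

/-! ## The theorem -/

variable (K N)

/-- Block scalar `1` on the side pattern `s`. [folklore] -/
def Ppow (s : Fin N → Fin 2) : Matrix (Fin N → Leaf2) (Fin N → Leaf2) K :=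
  Matrix.of fun a d => if a = d ∧ (fun i => side (a i)) = s then 1 else 0

/-- Entries of a combination of block scalars. [folklore] -/
theorem sum_Ppow_apply (μ : (Fin N → Fin 2) → K) (a d : Fin N → Leaf2) :
    (∑ s, μ s • Ppow K N s) a d = if a = d then μ (fun i => side (a i)) else 0 := by
  simp only [Matrix.sum_apply, Matrix.smul_apply, Ppow, Matrix.of_apply, smul_eq_mul, mul_ite,
    mul_one, mul_zero]
  by_cases had : a = d
  · simp only [had, true_and, if_true]
    rw [Finset.sum_eq_single (fun i => side (d i))]
    · simp
    · intro s _ hs; rw [if_neg (fun h => hs h.symm)]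
    · simp
  · simp [had]

/-- The candidate commutant at a generic point: pairs of equal block scalars. [folklore] -/
def blockScalarsPow : Submodule K (Matrix (Fin N → Leaf2) (Fin N → Leaf2) K ×
    Matrix (Fin N → Leaf2) (Fin N → Leaf2) K) :=
  LinearMap.range (Fintype.linearCombination K (fun s : Fin N → Fin 2 => (Ppow K N s, Ppow K N s)))

/-- `dim blockScalarsPow ≤ 2^N < 4^N`. [folklore] -/
theorem finrank_blockScalarsPow_lt (hN : 1 ≤ N) :
    Module.finrank K (blockScalarsPow K N) < Fintype.card ((Fin N → Fin 2) × (Fin N → Fin 2)) := by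
  refine (LinearMap.finrank_range_le _).trans_lt ?_
  simp only [Module.finrank_fintype_fun_eq_card, Fintype.card_prod, Fintype.card_fun,
    Fintype.card_fin]
  have h2 : 1 < 2 ^ N := Nat.one_lt_two_pow (by omega)
  nlinarith [Nat.two_pow_pos N]

/-- **`𝔖(1)^{⊠N} ⋭ 𝔖(q)^{⊠N}` for `q ∉ {0,1}`, `N ≥ 1`, every field.**
[cite: BurgisserClausenShokrollahi1997, (15.19)] -/
theorem fam_one_pow_not_algDegeneratesTo_fam_pow {q : K} (hq0 : q ≠ 0) (hq1 : q ≠ 1)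
    (hN : 1 ≤ N) :
    ¬ AlgDegeneratesTo (kroneckerPow (fam K 1) N) (kroneckerPow (fam K q) N) := by
  refine not_algDegeneratesTo_of_commutant (R₀ := (Fin N → Fin 2) × (Fin N → Fin 2))
    (kroneckerPow (fam K 1) N) (kroneckerPow (fam K q) N) (βpow K N) (βpow K N) (hcommPow K N)
    (βpow_linearIndependent K N) (blockScalarsPow K N) ?_ (finrank_blockScalarsPow_lt K N hN)
  intro β' γ' H
  refine ⟨fun s => β' (mk s fun _ => 0) (mk s fun _ => 0), ?_⟩
  rw [Fintype.linearCombination_apply]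
  refine Prod.ext ?_ ?_
  · rw [Prod.fst_sum]
    ext a d
    simp only [Prod.smul_fst]
    rw [sum_Ppow_apply]
    exact ((comm_fam_pow hq0 hq1 H a d).1).symm
  · rw [Prod.snd_sum]
    ext a d
    simp only [Prod.smul_snd]
    rw [sum_Ppow_apply]
    exact ((comm_fam_pow hq0 hq1 H a d).2).symm

/-- **`⟨2,2,2⟩^{⊠N} ⋭ 𝔖(q)^{⊠N}` for every `N ≥ 1`, every `q ∉ {0,1}`, every field**: no
Kronecker power of matrix multiplication degenerates to the same power of a non-coherent member
of its own same-support normal-form family.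
[cite: BurgisserClausenShokrollahi1997, (15.19)] [cite: BlaserChristandlZuiddam2017, §2] -/
theorem matMul_pow_not_algDegeneratesTo_fam_pow {q : K} (hq0 : q ≠ 0) (hq1 : q ≠ 1)
    (hN : 1 ≤ N) :
    ¬ AlgDegeneratesTo (kroneckerPow (matMulTensor K 2 2 (1 + 1)) N)
      (kroneckerPow (fam K q) N) := fun h =>
  fam_one_pow_not_algDegeneratesTo_fam_pow K N hq0 hq1 hN (by
    rw [fam_one]
    exact ((permStar_restrictsTo_matMul IsProdPerm.refl).kroneckerPow N).algDegeneratesTo_trans h)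

end Summit.MatrixMultiplication.MatrixMultiplication.Theorems.FarEdgeDescentWeightFamilyPow

end
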